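import Summits.BirchSwinnertonDyer.BirchSwinnertonDyer.Theorems.ByReductionTypeAtTwoAdditivePotMultConjATwoNarrowTwo18796Units
import Summits.BirchSwinnertonDyer.BirchSwinnertonDyer.Theorems.ByReductionTypeAtTwoAdditivePotGoodLowerHalfT0NarrowRankStampsA
import Summits.BirchSwinnertonDyer.BirchSwinnertonDyer.Theorems.ByReductionTypeAtTwoOrdKatoHalfAtTwoIsoConjATwoOfNarrowRankLayerModels
import HarnessLib

/-!
# C4″ `AdditivePotMultOverKAtTwo` (item stmt-BirchSwinnertonDyer-22618), the (I1M′) input of the upper half on the `0 < Δ` rows: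
# LAYER-TWO NARROW CERTIFICATE `d = 18796`, part ROW `300736w1` — UNCONDITIONAL statement (A) at `2` (ZERO hypotheses, ZERO named facts) for the C4″
# census curve `300736w1` (`y² = x³ + (1)x² + (-26866017)x + (-53607506401)`), letter NARROW-EQUAL12 made KERNEL by the rung `m = 1`

Cell `bsd-2adic`, rung K4, seat `bsd-2adic-k4-w3` GEN 13 (explicit unit of director-bsd g16 (309)(7); `--supports stmt-BirchSwinnertonDyer-22618`).
HONEST FRAMING (D-0036/D-0054/D-0152): THEOREMS ONLY (no definition, no named fact, no `sorry`, no instance). The series `…NarrowTwo18796{Class, Field,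
Dyadic, Residues, TotPos, Integers, Parity, SignsA/B/C, Units, Rows}` carries k4-w1 GEN 11's zero-hypothesis LAYER-TWO narrow certificate (row `261648q1`,
`…NarrowRankCertificate316*`: `h(A₁)`, `h(A₂)` odd by genus theory with one dyadic non-norm unit, ONE totally positive non-square unit of `A₁ = ℚ(θ,√2)`,
ELEVEN sign-independent units of `A₂ = ℚ(θ,√(2+√2))`, k4-w2's Edgar–Mollin–Peterson door `a = 1, b = 11`, cruxlead-19573-w2's rung `m = 1`) to the
totally real cubic `2`-torsion field of discriminant `18796` (`X³ + (-1)X² + (-24)X + (46)`) of the C4″ census rows 300736w1 (eng-2 CERT-ADD-POTMULT-POS81-AB-E2: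
`n₀ = 0`, `rank₂ Cl⁺ = [0,1,1]`, unit signature ranks `[3,5,11]`, `h = 1` at layers `0,1,2` — letter NARROW-EQUAL12, instrument grade `grh`; here KERNEL).
All certificates were found by the seat's exact-arithmetic tools (`k4w3/gen13/tools`: GEN 12 `narrowcert/unitlib` + layer-two arithmetic `nf12/cert2`) and are CHECKED
HERE by the kernel. Statement (A) is NOT BSD: BSD₂ for these curves is not proved; C4″ / (I1M′) stay research-open; nothing booked; no row of 22618 changes tier
(pen RC-490 (4)); BSD is not proved by any of this.

References: [CoatesSujatha2005] Conj. A, Thm. 3.4; [Fukuda1994] Thm. 1 (2); [EdgarMollinPeterson1986] Thm. 2.1; [FrohlichTaylor1990] Ch. V §1 (1.8)–(1.13);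
[Lang1990] Ch. 13 §4 Lemma 4.1; [Washington1997] §13.1, Prop. 13.2; [Cohen1993] §4.1.3, §6.3; [Marcus1977] Ch. 5 Thm. 22, 35–37; [Omeara1963] §63.
-/

set_option autoImplicit false
-- sibling precedent: the directory name repeats the summit name
set_option linter.dupNamespace false

noncomputable section

open scoped Classical IntermediateField NumberField Real nonZeroDivisors

namespace Summit.BirchSwinnertonDyer.BirchSwinnertonDyer.Theorems.AddKatoTwo

open WeierstrassCurve Field Polynomial IsDedekindDomain NumberField Matrix Literature.NumberTheory.EllipticCurves
  Literature.NumberTheory.EllipticCurves.ZpExtension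
  Literature.NumberTheory.GaloisRepresentations
  Literature.NumberTheory.IwasawaTheory
  Literature.NumberTheory.NumberFields
  Summit.BirchSwinnertonDyer.BirchSwinnertonDyer.Theorems.SteinbergFibreAtTwo
  Summit.BirchSwinnertonDyer.BirchSwinnertonDyer.Theorems.AlignedTransportAtTwoTorsionPointField
  Summit.BirchSwinnertonDyer.BirchSwinnertonDyer.Theses.ByReductionTypeAtTwo

/-- **A monic integer cubic with a root `β` of degree `3` is irreducible** (restated to keep this file's imports minimal). [folklore] -/
private theorem irreducibleCubic_of_finrank_three_300736w1 {p q r : ℤ} {β : AlgebraicClosure ℚ}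
    (hβ : aeval β (Cubic.toPoly ⟨1, (p : ℚ), q, r⟩) = 0) (h3 : Module.finrank ℚ (IntermediateField.adjoin ℚ {β}) = 3) :
    Irreducible (Cubic.toPoly ⟨1, (p : ℚ), q, r⟩) := by
  have hfm : (Cubic.toPoly ⟨1, (p : ℚ), q, r⟩).Monic := Cubic.monic_of_a_eq_one'
  have hβint : IsIntegral ℚ β := ⟨_, hfm, by rwa [← aeval_def]⟩
  have hdeg : (minpoly ℚ β).natDegree = (Cubic.toPoly ⟨1, (p : ℚ), q, r⟩).natDegree := by
    rw [← IntermediateField.adjoin.finrank hβint, h3, Cubic.natDegree_of_a_ne_zero' one_ne_zero]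
  have heq : Cubic.toPoly ⟨1, (p : ℚ), q, r⟩ = minpoly ℚ β :=
    Polynomial.eq_of_monic_of_dvd_of_natDegree_le (minpoly.monic hβint) hfm (minpoly.dvd ℚ β hβ) hdeg.ge
  rw [heq]
  exact minpoly.irreducible hβint

set_option maxHeartbeats 1600000 in
/-- **UNCONDITIONAL (A)₂ for the C4″ census curve `300736w1` — ZERO hypotheses, ZERO named facts** (additive potentially multiplicative at `2`,
irreducible `E[2]`, `Δ > 0`). Coates–Sujatha's statement (A) at `p = 2`: for every cyclotomic `ℤ₂`-extension of `ℚ` the dual fine Selmer group of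
`[0, 1, 0, -26866017, -53607506401]` over `ℚ_∞` is finitely generated over `ℤ₂` (`∃ γ D` currency). KERNEL throughout: `2`-torsion point field `ℚ(x(T)) = ℚ(θ)`,
`θ³ + (-1)θ² + (-24)θ + (46) = 0` (`d = 18796`, totally real, `2 = 𝔭𝔮²`), and the narrow rank certificate one layer up
`[Cl⁺(ℚ(θ,√(2+√2))) : Cl⁺(…)²] = [Cl⁺(ℚ(θ,√2)) : Cl⁺(…)²]` (`= 2`, `…NarrowTwo18796Units`); cruxlead-19573-w2's concrete-model narrow-Fukuda rung `m = 1`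
(`NarrowRankRung.conjA_two_cubicModel_of_narrowRank_layer_models_eq`) does the rest. UPGRADES the instrument-tier letter NARROW-EQUAL12 (eng-2 POS81-AB, grh)
to KERNEL; statement (A) is NOT BSD — BSD₂ for `300736w1` is NOT proved by this. [cite: CoatesSujatha2005, Conj. A and Thm. 3.4]
[cite: Fukuda1994, Thm. 1 (2), p. 264] [cite: Washington1997, §13.1 and Lemma 13.3] [cite: EdgarMollinPeterson1986, Thm. 2.1] -/
theorem conjA_two_300736w1'' (κ : ZpExtension ℚ 2) (hκ : κ.IsCyclotomic) :
    haveI := (isElliptic_cubicModel _ _ _ (by simp only [Cubic.discr]; norm_num) :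
      (⟨0, ((1 : ℤ) : ℚ), 0, ((-26866017 : ℤ) : ℚ), ((-53607506401 : ℤ) : ℚ)⟩ : WeierstrassCurve ℚ).IsElliptic)
    ∃ (γ : absoluteGaloisGroup ℚ) (D : (⟨0, ((1 : ℤ) : ℚ), 0, ((-26866017 : ℤ) : ℚ), ((-53607506401 : ℤ) : ℚ)⟩ : WeierstrassCurve ℚ).FineSelmerDualData κ γ),
      Module.Finite ℤ_[2] (RestrictScalars ℤ_[2] (IwasawaAlgebra 2) D.X) := by
  haveI := (isElliptic_cubicModel _ _ _ (by simp only [Cubic.discr]; norm_num) :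
    (⟨0, ((1 : ℤ) : ℚ), 0, ((-26866017 : ℤ) : ℚ), ((-53607506401 : ℤ) : ℚ)⟩ : WeierstrassCurve ℚ).IsElliptic)
  -- a root `θ` of the cubic and the root `β` of the curve cubic
  obtain ⟨θ, hθ⟩ : ∃ θ : AlgebraicClosure ℚ, aeval θ (Cubic.toPoly ⟨1, ((-1 : ℤ) : ℚ), ((-24 : ℤ) : ℚ), ((46 : ℤ) : ℚ)⟩) = 0 :=
    IsAlgClosed.exists_aeval_eq_zero _ _ (by rw [Cubic.degree_of_a_ne_zero one_ne_zero]; norm_num)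
  have hθ' : θ ^ 3 + (-1 : AlgebraicClosure ℚ) * θ ^ 2 + (-24 : AlgebraicClosure ℚ) * θ + (46 : AlgebraicClosure ℚ) = 0 := by
    have := hθ
    simp only [Cubic.toPoly, map_one, one_mul, aeval_add, aeval_mul, aeval_C, aeval_X_pow, aeval_X,
      eq_ratCast, Rat.cast_intCast] at this
    push_cast at this
    linear_combination this
  obtain ⟨β, hβdef⟩ : ∃ β : AlgebraicClosure ℚ, β = algebraMap ℚ (AlgebraicClosure ℚ) (-1853 : ℚ) +
      algebraMap ℚ (AlgebraicClosure ℚ) (-812 : ℚ) * θ + algebraMap ℚ (AlgebraicClosure ℚ) (130 : ℚ) * θ ^ 2 := ⟨_, rfl⟩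
  have hβ : aeval β (Cubic.toPoly ⟨1, ((1 : ℤ) : ℚ), ((-26866017 : ℤ) : ℚ), ((-53607506401 : ℤ) : ℚ)⟩) = 0 := by
    simp only [Cubic.toPoly, map_one, one_mul, aeval_add, aeval_mul, aeval_C, aeval_X_pow, aeval_X, eq_ratCast,
      Rat.cast_intCast]
    rw [hβdef]
    simp only [eq_ratCast]
    push_cast
    linear_combination ((-221387408 : AlgebraicClosure ℚ) + (176970560 : AlgebraicClosure ℚ) * θ + (-38971400 : AlgebraicClosure ℚ) * θ ^ 2 + (2197000 : AlgebraicClosure ℚ) * θ ^ 3) * hθ'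
  have hadj : IntermediateField.adjoin ℚ {β} = IntermediateField.adjoin ℚ {θ} := by
    apply le_antisymm
    · rw [IntermediateField.adjoin_simple_le_iff, hβdef]
      have hθmem := IntermediateField.mem_adjoin_simple_self ℚ θ
      exact add_mem (add_mem (algebraMap_mem _ _) (mul_mem (algebraMap_mem _ _) hθmem))
        (mul_mem (algebraMap_mem _ _) (pow_mem hθmem 2))
    · rw [IntermediateField.adjoin_simple_le_iff]
      have hθeq : θ = algebraMap ℚ (AlgebraicClosure ℚ) (1164259001 / 256 : ℚ) +
          algebraMap ℚ (AlgebraicClosure ℚ) (24309 / 32 : ℚ) * β +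
          algebraMap ℚ (AlgebraicClosure ℚ) (-65 / 256 : ℚ) * β ^ 2 := by
        rw [hβdef]; simp only [eq_ratCast]; push_cast
        linear_combination (((-3156075 : AlgebraicClosure ℚ) / 64) + ((274625 : AlgebraicClosure ℚ) / 64) * θ) * hθ'
      rw [hθeq]
      have hβmem := IntermediateField.mem_adjoin_simple_self ℚ β
      exact add_mem (add_mem (algebraMap_mem _ _) (mul_mem (algebraMap_mem _ _) hβmem))
        (mul_mem (algebraMap_mem _ _) (pow_mem hβmem 2))
  haveI : FiniteDimensional ℚ (IntermediateField.adjoin ℚ {θ}) :=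
    IntermediateField.adjoin.finiteDimensional ((AlgebraicClosure.isAlgebraic ℚ).isAlgebraic θ).isIntegral
  haveI : FiniteDimensional ℚ ↥((CyclotomicZp.zpExtension 2).layer 1) := (CyclotomicZp.zpExtension 2).finiteDimensional_layer_holds 1
  haveI : FiniteDimensional ℚ ↥((CyclotomicZp.zpExtension 2).layer 2) := (CyclotomicZp.zpExtension 2).finiteDimensional_layer_holds 2
  haveI : NumberField (IntermediateField.adjoin ℚ {θ}) := NumberField.mk
  haveI : NumberField ↥(ℚ⟮θ⟯ ⊔ (CyclotomicZp.zpExtension 2).layer 1) := NumberField.mk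
  haveI : NumberField ↥(ℚ⟮θ⟯ ⊔ (CyclotomicZp.zpExtension 2).layer 2) := NumberField.mk
  have h3 := finrank_adjoin_eq_three_of_irreducible irreducible_cubic_d18796p hθ
  have h3β : Module.finrank ℚ (IntermediateField.adjoin ℚ {β}) = 3 := by rw [hadj]; exact h3
  haveI : NumberField (IntermediateField.adjoin ℚ {β}) := by rw [hadj]; infer_instance
  obtain ⟨-, hfin1, -⟩ := layer_one_basics irreducible_cubic_d18796p hθ (isTotallyReal_adjoin_d18796p hθ)
  obtain ⟨-, hfin2, -⟩ := layer_two_basics irreducible_cubic_d18796p hθ (isTotallyReal_adjoin_d18796p hθ)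
  -- the models `A₁ = ℚ(θ) ⊔ ℚ_1 ∋ t = e² − 2`, `A₂ = ℚ(θ) ⊔ ℚ_2 ∋ e`
  obtain ⟨e, he, -, he4⟩ := CyclotomicZp.exists_mem_layer_two_quartic_zpExtension
  have he0 : (fun x : AlgebraicClosure ℚ => x ^ 2 - 2)^[2] e = 0 := by
    simp only [Function.iterate_succ, Function.iterate_zero, Function.comp_apply, id_eq]
    linear_combination he4
  obtain ⟨ht, ht2⟩ := sq_sub_two_mem_layer_one_d316 he0
  have heA : e ∈ ℚ⟮θ⟯ ⊔ (CyclotomicZp.zpExtension 2).layer 2 := (le_sup_right : (CyclotomicZp.zpExtension 2).layer 2 ≤ _) he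
  have htA : e ^ 2 - 2 ∈ ℚ⟮θ⟯ ⊔ (CyclotomicZp.zpExtension 2).layer 1 := (le_sup_right : (CyclotomicZp.zpExtension 2).layer 1 ≤ _) ht
  have hβ1 : IntermediateField.adjoin ℚ {β} ≤ ℚ⟮θ⟯ ⊔ (CyclotomicZp.zpExtension 2).layer 1 := hadj.le.trans le_sup_left
  have hβ2 : IntermediateField.adjoin ℚ {β} ≤ ℚ⟮θ⟯ ⊔ (CyclotomicZp.zpExtension 2).layer 2 := hadj.le.trans le_sup_left
  letI : Algebra ↥(IntermediateField.adjoin ℚ {β}) ↥(ℚ⟮θ⟯ ⊔ (CyclotomicZp.zpExtension 2).layer 1) :=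
    (IntermediateField.inclusion hβ1).toRingHom.toAlgebra
  letI : Algebra ↥(IntermediateField.adjoin ℚ {β}) ↥(ℚ⟮θ⟯ ⊔ (CyclotomicZp.zpExtension 2).layer 2) :=
    (IntermediateField.inclusion hβ2).toRingHom.toAlgebra
  haveI : IsScalarTower ℚ ↥(IntermediateField.adjoin ℚ {β}) ↥(ℚ⟮θ⟯ ⊔ (CyclotomicZp.zpExtension 2).layer 1) :=
    IsScalarTower.of_algebraMap_eq fun q => ((IntermediateField.inclusion hβ1).commutes q).symm
  haveI : IsScalarTower ℚ ↥(IntermediateField.adjoin ℚ {β}) ↥(ℚ⟮θ⟯ ⊔ (CyclotomicZp.zpExtension 2).layer 2) :=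
    IsScalarTower.of_algebraMap_eq fun q => ((IntermediateField.inclusion hβ2).commutes q).symm
  haveI : Module.Finite ↥(IntermediateField.adjoin ℚ {β}) ↥(ℚ⟮θ⟯ ⊔ (CyclotomicZp.zpExtension 2).layer 1) :=
    Module.Finite.of_restrictScalars_finite ℚ _ _
  haveI : Module.Finite ↥(IntermediateField.adjoin ℚ {β}) ↥(ℚ⟮θ⟯ ⊔ (CyclotomicZp.zpExtension 2).layer 2) :=
    Module.Finite.of_restrictScalars_finite ℚ _ _
  have hL1 : Module.finrank ↥(IntermediateField.adjoin ℚ {β}) ↥(ℚ⟮θ⟯ ⊔ (CyclotomicZp.zpExtension 2).layer 1) = 2 ^ 1 := by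
    have htower := Module.finrank_mul_finrank ℚ ↥(IntermediateField.adjoin ℚ {β}) ↥(ℚ⟮θ⟯ ⊔ (CyclotomicZp.zpExtension 2).layer 1)
    rw [h3β, hfin1] at htower
    omega
  have hL2 : Module.finrank ↥(IntermediateField.adjoin ℚ {β}) ↥(ℚ⟮θ⟯ ⊔ (CyclotomicZp.zpExtension 2).layer 2) = 2 ^ (1 + 1) := by
    have htower := Module.finrank_mul_finrank ℚ ↥(IntermediateField.adjoin ℚ {β}) ↥(ℚ⟮θ⟯ ⊔ (CyclotomicZp.zpExtension 2).layer 2)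
    rw [h3β, hfin2] at htower
    omega
  have ht1 : (fun x : ↥(ℚ⟮θ⟯ ⊔ (CyclotomicZp.zpExtension 2).layer 1) => x ^ 2 - 2)^[1]
      (⟨e ^ 2 - 2, htA⟩ : ↥(ℚ⟮θ⟯ ⊔ (CyclotomicZp.zpExtension 2).layer 1)) = 0 := by
    apply (algebraMap ↥(ℚ⟮θ⟯ ⊔ (CyclotomicZp.zpExtension 2).layer 1) (AlgebraicClosure ℚ)).injective
    rw [NestedSqrtTwo.map_iterate, map_zero]
    simp only [Function.iterate_one]
    change (e ^ 2 - 2) ^ 2 - 2 = 0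
    linear_combination ht2
  have he2 : (fun x : ↥(ℚ⟮θ⟯ ⊔ (CyclotomicZp.zpExtension 2).layer 2) => x ^ 2 - 2)^[1 + 1]
      (⟨e, heA⟩ : ↥(ℚ⟮θ⟯ ⊔ (CyclotomicZp.zpExtension 2).layer 2)) = 0 := by
    apply (algebraMap ↥(ℚ⟮θ⟯ ⊔ (CyclotomicZp.zpExtension 2).layer 2) (AlgebraicClosure ℚ)).injective
    rw [NestedSqrtTwo.map_iterate, map_zero]
    exact he0
  have hr := (index_range_pow_two_narrowClassGroup_adjoin_sup_layer_two_d18796 hθ).1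
  exact NarrowRankRung.conjA_two_cubicModel_of_narrowRank_layer_models_eq (1) (-26866017) (-53607506401)
    (irreducibleCubic_of_finrank_three_300736w1 hβ h3β) hβ 1 le_rfl ↥(ℚ⟮θ⟯ ⊔ (CyclotomicZp.zpExtension 2).layer 1) hL1 _ ht1
    ↥(ℚ⟮θ⟯ ⊔ (CyclotomicZp.zpExtension 2).layer 2) hL2 _ he2 hr κ hκ


end Summit.BirchSwinnertonDyer.BirchSwinnertonDyer.Theorems.AddKatoTwo

end
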